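import Literature.Geometry.Riemannian.HeatKernelSpaceTimeDensity
import Literature.Geometry.Riemannian.LinearHeatWeakRegularity
import Literature.Geometry.Riemannian.RicciFlowDensityRatioDeriv
import Mathlib.MeasureTheory.Measure.HasOuterApproxClosed
import Literature.Geometry.Riemannian.ChartTestFunctions
import HarnessLib

/-!
# The conjugate heat kernel of a Ricci flow on a closed manifold: existence, smoothness and the
# conjugate heat equation (Bamler 2020a, §2.3)

R. Bamler, *Entropy and heat kernel bounds on a Ricci flow background*, arXiv:2008.07093 (2020a),
§2.3: on a compact Ricci flow "we denote by `K(x,t;y,s)`, `s < t`, the heat kernel … for fixed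
`(x,t)` the function `K(x,t;·,·)` is a conjugate heat kernel based at `(x,t)`:
`□*_{(y,s)} K(x,t;y,s) = 0`, `(−∂ₛ − Δ_{g_s} + R) K = 0` … the conjugate heat kernel measures are
`dν_{x,t;s} := K(x,t;·,s) dg_s`". The tree built the probability measures `ν_{x,t;s}` directly
from the solution operator (`heatKernelMeasure`, `HeatKernelMeasures.lean`). This file PROVES
the existence of the smooth kernel: for a `C^∞` family `h` of Riemannian metrics on a closed
manifold `M` (modelled on `ℝᵐ`) which is a Ricci flow `(h, cov)` on `[a, t]`, and `x ∈ M`, there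
is `K = K(x,t;·,·)`, `C^∞` on `M × (a, t)`, nonnegative, with

  `ν_{x,t;s} = K(·, s) dV_{h(s)}`  for EVERY `s ∈ (a, t)`,  and  `∂ₛK = −Δ_{h(s)}K + R K`  on `M × (a, t)`

(`IsRicciFlow.exists_conjugateHeatKernel`). No parametrix is used: the space-time density of
`dν_{x,t;−σ} dσ` is a very weak solution of the (time-reversed) conjugate heat equation
(`HeatKernelSpaceTimeDensity.lean`, from the duality of `HeatKernelVeryWeak.lean`), Hörmander's
hypoellipticity theorem in the tree's manifold form
(`exists_contMDiffOn_ae_eq_of_linearHeat_veryWeak`, `LinearHeatWeakRegularity.lean`) makes it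
smooth, the identification for every time (not only almost every) follows from the continuity of
`s ↦ ν_{x,t;s}` (`HeatKernelTimeRegularity.lean`) and of the smooth side, and smooth very weak
solutions are classical (`linearHeat_classical_of_veryWeak_of_contMDiffOn`), the zeroth-order
coefficient `∂_σρ̃/ρ̃` being the scalar curvature along the Ricci flow
(`IsRicciFlow.deriv_densityRatio_comp_neg_div`).

Everything is proved; no definitions, no named facts. What is NOT here: strict positivity
`K > 0`, the heat equation in the variables `(x, t)`, symmetry/semigroup identities of `K`, and
Gaussian bounds (Bamler 2020a, §7).

## References

* R. H. Bamler, *Entropy and heat kernel bounds on a Ricci flow background*, arXiv:2008.07093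
  (2020), §2.3. [Bamler2020Entropy]
* L. Hörmander, *Hypoelliptic second order differential equations*, Acta Math. 119 (1967),
  Thm. 1.1. [Hormander1967]
-/

noncomputable section

open Bundle Set Function Filter Manifold MeasureTheory Measure TopologicalSpace
open scoped Manifold ContDiff Topology ENNReal NNReal BoundedContinuousFunction

namespace Literature.Geometry.Riemannian

open Lorentzian Lorentzian.PseudoRiemannianMetric

section ConjugateHeatKernel

variable {m : ℕ} {H : Type*} [TopologicalSpace H]
  {I : ModelWithCorners ℝ (EuclideanSpace ℝ (Fin m)) H} [I.Boundaryless]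
  {M : Type*} [TopologicalSpace M] [ChartedSpace H M] [IsManifold I ∞ M]
  [T2Space M] [CompactSpace M] [SecondCountableTopology M] [MeasurableSpace M] [BorelSpace M]
  {h : ℝ → PseudoRiemannianMetric I ∞ (EuclideanSpace ℝ (Fin m)) (TangentSpace I : M → Type _)}
  {cov : ℝ → CovariantDerivative I (EuclideanSpace ℝ (Fin m)) (TangentSpace I : M → Type _)}

variable (hh : IsContMDiffFamilyOn ∞ h univ) (hR : ∀ r, (h r).IsRiemannian)

/-- **The conjugate heat kernel of a Ricci flow on a closed manifold** (Bamler 2020a, §2.3). Let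
`h` be a `C^∞` family of Riemannian metrics on the closed manifold `M` which is a Ricci flow
`(h, cov)` on `[a, t]`, `a < t`, and `x ∈ M`. There is a function `K` (`= K(x,t;·,·)`), `C^∞` on
`M × (a, t)` and nonnegative there, such that for every `s ∈ (a, t)` the heat kernel measure is
`ν_{x,t;s} = K(·, s) dV_{h(s)}`, and `K` solves the conjugate heat equation
`∂ₛK(y, s) = −Δ_{h(s)}K(·, s)(y) + R(y, s) K(y, s)` at every point of `M × (a, t)`.
[cite: Bamler2020Entropy, §2.3] -/
theorem IsRicciFlow.exists_conjugateHeatKernel {a t : ℝ} (hat : a < t)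
    (hflow : IsRicciFlow h cov (Icc a t)) (x : M) :
    ∃ K : M × ℝ → ℝ, ContMDiffOn (I.prod 𝓘(ℝ, ℝ)) 𝓘(ℝ, ℝ) ∞ K (univ ×ˢ Ioo a t) ∧
      (∀ p ∈ univ ×ˢ Ioo a t, 0 ≤ K p) ∧
      (∀ s ∈ Ioo a t, heatKernelMeasure hh hR t x s =
        (h s).riemVolume.withDensity fun y ↦ ENNReal.ofReal (K (y, s))) ∧
      (∀ p ∈ univ ×ˢ Ioo a t, deriv (fun s ↦ K (p.1, s)) p.2 =
        -(h p.2).laplaceBeltrami (fun y ↦ K (y, p.2)) p.1 +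
          (h p.2).scalarCurvatureWith (cov p.2) p.1 * K p) ∧
      -- the very weak heat-type equation in the reversed time `σ = -s` (format of
      -- `exists_contMDiffOn_ae_eq_of_linearHeat_veryWeak` for the family `σ ↦ h (-σ)`, `g₀ = h 0`,
      -- `Q = ∂_σρ̃/ρ̃`, `G = 0`), kept for quantitative regularity arguments
      (∀ ζ : M × ℝ → ℝ, ContMDiff (I.prod 𝓘(ℝ, ℝ)) 𝓘(ℝ, ℝ) ∞ ζ → HasCompactSupport ζ →
        tsupport ζ ⊆ univ ×ˢ Ioo (-t) (-a) →
        ∫ p, K (p.1, -p.2) * (-(deriv (fun s ↦ (h (-s)).densityRatio (h 0) p.1 * ζ (p.1, s)) p.2) -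
            (h (-p.2)).densityRatio (h 0) p.1 *
              (h (-p.2)).laplaceBeltrami (fun y ↦ ζ (y, p.2)) p.1 +
            (h (-p.2)).densityRatio (h 0) p.1 *
              (deriv (fun s ↦ (h (-s)).densityRatio (h 0) p.1) p.2 /
                (h (-p.2)).densityRatio (h 0) p.1) * ζ p)
            ∂(h 0).riemVolume.prod (volume : Measure ℝ) = 0) := by
  haveI : MetrizableSpace M := Manifold.metrizableSpace I M
  -- the reversed setting
  set μ₀ : Measure M := (h 0).riemVolume with hμ₀
  haveI : IsFiniteMeasure μ₀ := ⟨(h 0).riemVolume_univ_lt_top⟩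
  haveI : μ₀.IsOpenPosMeasure := by
    rw [hμ₀, riemVolume_eq (hR 0)]; exact isOpenPosMeasure_riemannianMeasure _
  haveI : (μ₀.prod (volume : Measure ℝ)).IsOpenPosMeasure := prod.instIsOpenPosMeasure
  set T : Set ℝ := Ioo (-t) (-a) with hT
  have hTo : IsOpen T := isOpen_Ioo
  have hh' : IsContMDiffFamilyOn ∞ (fun σ ↦ h (-σ)) univ := IsContMDiffFamilyOn.comp_neg hh
  have hR' : ∀ σ, (h (-σ)).IsRiemannian := fun σ ↦ hR _
  set ρ : M × ℝ → ℝ := fun p ↦ (h (-p.2)).densityRatio (h 0) p.1 with hρ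
  have hρs : ContMDiff (I.prod 𝓘(ℝ, ℝ)) 𝓘(ℝ, ℝ) ∞ ρ := contMDiff_densityRatio_comp_neg hh hR
  have hρpos : ∀ p, 0 < ρ p := fun p ↦ densityRatio_pos (hR _) (hR 0) _
  set Q : ℝ → M → ℝ := fun σ y ↦
    deriv (fun s ↦ (h (-s)).densityRatio (h 0) y) σ / (h (-σ)).densityRatio (h 0) y with hQ
  have hQs : ContMDiff (I.prod 𝓘(ℝ, ℝ)) 𝓘(ℝ, ℝ) ∞ fun p : M × ℝ ↦ Q p.2 p.1 :=
    contMDiff_deriv_densityRatio_div hh hR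
  have hG : ContMDiff (I.prod 𝓘(ℝ, ℝ)) 𝓘(ℝ, ℝ) ∞ fun p : M × ℝ ↦ (fun (_ : ℝ) (_ : M) ↦ (0 : ℝ)) p.2 p.1 :=
    contMDiff_const
  -- the very weak density and its smooth representative (hypoellipticity)
  obtain ⟨u, hum, hu0, huint, hid, hweak⟩ := hflow.exists_reversed_veryWeak_density hh hR hat x
  have hweak' : ∀ ζ : M × ℝ → ℝ, ContMDiff (I.prod 𝓘(ℝ, ℝ)) 𝓘(ℝ, ℝ) ∞ ζ → HasCompactSupport ζ →
      tsupport ζ ⊆ univ ×ˢ T →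
      ∫ p, u p * (-(deriv (fun s ↦ (h (-s)).densityRatio (h 0) p.1 * ζ (p.1, s)) p.2) -
          (h (-p.2)).densityRatio (h 0) p.1 * (h (-p.2)).laplaceBeltrami (fun y ↦ ζ (y, p.2)) p.1 +
          (h (-p.2)).densityRatio (h 0) p.1 * Q p.2 p.1 * ζ p) ∂μ₀.prod (volume : Measure ℝ) =
        ∫ p, (h (-p.2)).densityRatio (h 0) p.1 * (fun (_ : ℝ) (_ : M) ↦ (0 : ℝ)) p.2 p.1 * ζ p
          ∂μ₀.prod (volume : Measure ℝ) := by
    intro ζ h1 h2 h3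
    rw [hweak ζ h1 h2 h3]
    simp
  obtain ⟨v, hv, hae⟩ := exists_contMDiffOn_ae_eq_of_linearHeat_veryWeak (h := fun σ ↦ h (-σ))
    (g₀ := h 0) (G := fun (_ : ℝ) (_ : M) ↦ (0 : ℝ)) hh' hR' (hR 0) hQs hG hTo hum
    huint.locallyIntegrableOn hweak'
  -- `v ≥ 0` on `M × T`
  have hv0 : ∀ p ∈ univ ×ˢ T, 0 ≤ v p :=
    nonneg_of_ae_of_continuousOn (μ := μ₀.prod (volume : Measure ℝ)) (isOpen_univ.prod hTo)
      hv.continuousOn (hae.mono fun p hp hpT ↦ by rw [← hp hpT]; exact hu0 p)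
  -- identification for EVERY `σ ∈ T`: `∫ f dν_{x,t;−σ} = ∫ f v(·,σ) ρ(·,σ) dμ₀` for continuous `f`
  have hident : ∀ (f : M → ℝ), Continuous f → EqOn
      (fun σ ↦ ∫ y, f y ∂(heatKernelMeasure hh hR t x (-σ)))
      (fun σ ↦ ∫ y, f y * v (y, σ) * ρ (y, σ) ∂μ₀) T := by
    intro f hf
    obtain ⟨B, hB⟩ : ∃ B, ∀ y, |f y| ≤ B := by
      obtain ⟨B, hB⟩ := isCompact_univ.exists_bound_of_continuousOn hf.continuousOn
      exact ⟨B, fun y ↦ (Real.norm_eq_abs _).symm.le.trans (hB y (mem_univ _))⟩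
    refine eqOn_of_forall_integral_mul_eq hTo ?_ ?_ fun θ hθ hθc hθT _ ↦ ?_
    · exact ((continuous_integral_heatKernelMeasure_left hh hR t x hf).comp
        continuous_neg).continuousOn
    · refine continuousOn_integral_of_continuousOn_prod_isOpen μ₀ hTo
        (F := fun σ y ↦ f y * v (y, σ) * ρ (y, σ)) ?_
      exact ((hf.comp continuous_fst).continuousOn.mul hv.continuousOn).mul hρs.continuous.continuousOn
    · -- both sides equal `∫ u ρ (f ⊗ θ) d(μ₀ ⊗ dσ)`
      obtain ⟨Cθ, hCθ⟩ : ∃ C, ∀ σ, |θ σ| ≤ C := by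
        obtain ⟨C, hC⟩ := hθc.isCompact.exists_bound_of_continuousOn hθ.continuousOn
        refine ⟨max C 0, fun σ ↦ ?_⟩
        by_cases hσ : σ ∈ tsupport θ
        · exact ((Real.norm_eq_abs _).symm.le.trans (hC σ hσ)).trans (le_max_left _ _)
        · rw [image_eq_zero_of_notMem_tsupport hσ, abs_zero]; exact le_max_right _ _
      have hZ := hid (fun p ↦ f p.1 * θ p.2) ((hf.comp continuous_fst).mul (hθ.comp continuous_snd))
        ⟨B * Cθ, fun p ↦ by
          rw [abs_mul]
          exact mul_le_mul (hB p.1) (hCθ p.2) (abs_nonneg _) ((abs_nonneg _).trans (hB p.1))⟩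
      -- left side
      have hL : ∫ σ, θ σ * ∫ y, f y ∂(heatKernelMeasure hh hR t x (-σ)) =
          ∫ σ in T, ∫ y, (fun p : M × ℝ ↦ f p.1 * θ p.2) (y, σ) ∂(heatKernelMeasure hh hR t x (-σ)) := by
        have e1 : ∀ σ, ∫ y, (fun p : M × ℝ ↦ f p.1 * θ p.2) (y, σ) ∂(heatKernelMeasure hh hR t x (-σ)) =
            θ σ * ∫ y, f y ∂(heatKernelMeasure hh hR t x (-σ)) := fun σ ↦ by
          simp only [integral_mul_const]; ring
        simp only [e1]
        symm
        refine setIntegral_eq_integral_of_forall_compl_eq_zero fun σ hσ ↦ ?_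
        rw [image_eq_zero_of_notMem_tsupport (fun h' ↦ hσ (hθT h')), zero_mul]
      -- right side
      set k : M × ℝ → ℝ := fun p ↦ ρ p * (f p.1 * θ p.2) with hk
      have hkc : Continuous k := hρs.continuous.mul ((hf.comp continuous_fst).mul (hθ.comp continuous_snd))
      have hkT : tsupport k ⊆ univ ×ˢ T := by
        intro p hp
        have h1 : p ∈ tsupport fun p : M × ℝ ↦ θ p.2 :=
          tsupport_mul_subset_right (tsupport_mul_subset_right hp)
        have h2 : p.2 ∈ tsupport θ := by
          have e : tsupport (fun p : M × ℝ ↦ θ p.2) = (univ : Set M) ×ˢ tsupport θ := by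
            have e1 : support (fun p : M × ℝ ↦ θ p.2) = (univ : Set M) ×ˢ support θ := by
              ext q; simp [mem_support]
            rw [tsupport, e1, closure_prod_eq, closure_univ]
            rfl
          rw [e] at h1
          exact h1.2
        exact ⟨mem_univ _, hθT h2⟩
      have hkcs : HasCompactSupport k := by
        refine HasCompactSupport.of_support_subset_isCompact
          (isCompact_univ.prod hθc.isCompact) fun p hp ↦ ⟨mem_univ _, ?_⟩
        have h1 : p ∈ support (fun q : M × ℝ ↦ θ q.2) :=
          support_mul_subset_right (fun q : M × ℝ ↦ f q.1) _ (support_mul_subset_right ρ _ hp)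
        exact subset_tsupport θ h1
      have hvk : Continuous fun p ↦ v p * k p :=
        continuous_mul_of_continuousOn_of_tsupport_subset (isOpen_univ.prod hTo) hv.continuousOn hkc hkT
      have hvki : Integrable (fun p ↦ v p * k p) (μ₀.prod (volume : Measure ℝ)) :=
        hvk.integrable_of_hasCompactSupport hkcs.mul_left
      have hRside : ∫ σ, θ σ * ∫ y, f y * v (y, σ) * ρ (y, σ) ∂μ₀ =
          ∫ p, v p * k p ∂μ₀.prod (volume : Measure ℝ) := by
        rw [integral_prod_symm _ hvki]
        refine integral_congr_ae (Eventually.of_forall fun σ ↦ ?_)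
        show θ σ * ∫ y, f y * v (y, σ) * ρ (y, σ) ∂μ₀ = ∫ y, v (y, σ) * k (y, σ) ∂μ₀
        rw [← integral_const_mul]
        refine integral_congr_ae (Eventually.of_forall fun y ↦ ?_)
        simp only [hk]; ring
      -- the a.e. identity `u = v` on `M × T` (where `k ≠ 0`)
      have hae' : (fun p ↦ u p * k p) =ᵐ[μ₀.prod (volume : Measure ℝ)] fun p ↦ v p * k p := by
        filter_upwards [hae] with p hp
        by_cases hkp : k p = 0
        · simp [hkp]
        · rw [hp (hkT (subset_tsupport _ hkp))]
      rw [hL, ← hZ, hRside, ← integral_congr_ae hae']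
      refine integral_congr_ae (Eventually.of_forall fun p ↦ ?_)
      simp only [hk]; ring
  -- the measure identity for every `σ ∈ T`
  have hmeas : ∀ σ ∈ T, heatKernelMeasure hh hR t x (-σ) =
      (h (-σ)).riemVolume.withDensity fun y ↦ ENNReal.ofReal (v (y, σ)) := by
    intro σ hσ
    have hvσ : Continuous fun y ↦ v (y, σ) :=
      (hv.continuousOn.comp_continuous (continuous_id.prodMk continuous_const)
        fun y ↦ ⟨mem_univ _, hσ⟩ :)
    have hvσ0 : ∀ y, 0 ≤ v (y, σ) := fun y ↦ hv0 (y, σ) ⟨mem_univ _, hσ⟩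
    haveI : IsFiniteMeasure (h (-σ)).riemVolume := ⟨(h (-σ)).riemVolume_univ_lt_top⟩
    haveI : IsFiniteMeasure ((h (-σ)).riemVolume.withDensity fun y ↦ ENNReal.ofReal (v (y, σ))) := by
      refine isFiniteMeasure_withDensity_ofReal ?_
      exact (hvσ.integrable_of_hasCompactSupport (HasCompactSupport.of_compactSpace _)).hasFiniteIntegral
    refine ext_of_forall_integral_eq_of_IsFiniteMeasure fun g ↦ ?_
    have e : ∫ y, g y ∂(heatKernelMeasure hh hR t x (-σ)) = ∫ y, g y * v (y, σ) * ρ (y, σ) ∂μ₀ :=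
      hident g g.continuous hσ
    rw [integral_withDensity_eq_integral_toReal_smul hvσ.measurable.ennreal_ofReal
      (Eventually.of_forall fun _ ↦ ENNReal.ofReal_lt_top), e]
    rw [hμ₀, ← integral_riemVolume_eq_integral_mul_densityRatio (hR (-σ)) (hR 0)]
    refine integral_congr_ae (Eventually.of_forall fun y ↦ ?_)
    show g y * v (y, σ) = (ENNReal.ofReal (v (y, σ))).toReal • g y
    rw [ENNReal.toReal_ofReal (hvσ0 y), smul_eq_mul, mul_comm]
  -- the classical equation for `v` in reversed time
  have hweakv : ∀ ζ : M × ℝ → ℝ, ContMDiff (I.prod 𝓘(ℝ, ℝ)) 𝓘(ℝ, ℝ) ∞ ζ → HasCompactSupport ζ →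
      tsupport ζ ⊆ univ ×ˢ T →
      ∫ p, v p * (-(deriv (fun s ↦ (h (-s)).densityRatio (h 0) p.1 * ζ (p.1, s)) p.2) -
          (h (-p.2)).densityRatio (h 0) p.1 * (h (-p.2)).laplaceBeltrami (fun y ↦ ζ (y, p.2)) p.1 +
          (h (-p.2)).densityRatio (h 0) p.1 * Q p.2 p.1 * ζ p) ∂μ₀.prod (volume : Measure ℝ) =
        ∫ p, (h (-p.2)).densityRatio (h 0) p.1 * (fun (_ : ℝ) (_ : M) ↦ (0 : ℝ)) p.2 p.1 * ζ p
          ∂μ₀.prod (volume : Measure ℝ) := by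
    intro ζ h1 h2 h3
    rw [← hweak' ζ h1 h2 h3]
    refine integral_congr_ae ?_
    filter_upwards [hae] with p hp
    by_cases hpζ : p ∈ tsupport ζ
    · rw [hp (h3 hpζ)]
    · -- the bracket vanishes outside `tsupport ζ`
      obtain ⟨y, σ⟩ := p
      obtain ⟨hd, hL⟩ := deriv_eq_zero_and_laplaceBeltrami_eq_zero_of_notMem_tsupport (h (-σ)) hpζ
      have hζ0 : ζ (y, σ) = 0 := image_eq_zero_of_notMem_tsupport hpζ
      have hdρζ : deriv (fun s ↦ (h (-s)).densityRatio (h 0) y * ζ (y, s)) σ = 0 := by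
        rw [deriv_fun_mul (differentiableAt_time_of_contMDiff hρs y σ)
          (differentiableAt_time_of_contMDiff h1 y σ), hd, hζ0]
        ring
      simp [hL, hζ0, hdρζ]
  have hclass := linearHeat_classical_of_veryWeak_of_contMDiffOn (h := fun σ ↦ h (-σ)) (g₀ := h 0)
    (G := fun (_ : ℝ) (_ : M) ↦ (0 : ℝ)) hh' hR' (hR 0) hQs hG hTo hv hweakv
  -- `Q(σ, y) = R(y, −σ)` for `σ ∈ T`
  have hQR : ∀ σ ∈ T, ∀ y, Q σ y = (h (-σ)).scalarCurvatureWith (cov (-σ)) y := by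
    intro σ hσ y
    have hs : -σ ∈ interior (Icc a t) := by
      rw [interior_Icc]; exact ⟨by linarith [hσ.2], by linarith [hσ.1]⟩
    exact hflow.deriv_densityRatio_comp_neg_div (convex_Icc a t) (fun r _ ↦ hR r) (hR 0) hs y
  -- forward time: `K(y, s) = v(y, −s)`
  refine ⟨fun p ↦ v (p.1, -p.2), ?_, ?_, ?_, ?_, fun ζ h1 h2 h3 ↦ ?_⟩
  · refine hv.comp (contMDiff_fst.prodMk contMDiff_snd.neg).contMDiffOn ?_
    rintro ⟨y, s⟩ ⟨-, hs⟩
    exact ⟨mem_univ _, by simp only; exact ⟨by linarith [hs.2], by linarith [hs.1]⟩⟩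
  · rintro ⟨y, s⟩ ⟨-, hs⟩
    exact hv0 (y, -s) ⟨mem_univ _, ⟨by linarith [hs.2], by linarith [hs.1]⟩⟩
  · intro s hs
    have key := hmeas (-s) ⟨by linarith [hs.2], by linarith [hs.1]⟩
    simpa only [neg_neg] using key
  · rintro ⟨y, s⟩ ⟨-, hs⟩
    have hσ : -s ∈ T := ⟨by linarith [hs.2], by linarith [hs.1]⟩
    have key := hclass (y, -s) ⟨mem_univ _, hσ⟩
    simp only [neg_neg] at key
    rw [hQR (-s) hσ y] at key
    simp only [neg_neg] at key
    -- `deriv (s' ↦ v(y, −s')) s = −deriv (σ ↦ v(y, σ)) (−s)`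
    have hd : deriv (fun s' ↦ v (y, -s')) s = -deriv (fun σ ↦ v (y, σ)) (-s) :=
      deriv_comp_neg (fun σ ↦ v (y, σ)) s
    show deriv (fun s' ↦ v (y, -s')) s = -(h s).laplaceBeltrami (fun y' ↦ v (y', -s)) y +
      (h s).scalarCurvatureWith (cov s) y * v (y, -s)
    rw [hd]
    linarith
  · have key := hweakv ζ h1 h2 h3
    simp only [neg_neg, mul_zero, zero_mul, integral_zero] at key ⊢
    exact key

end ConjugateHeatKernel

end Literature.Geometry.Riemannian
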